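import Summits.QuantumFields.YangMills.Theorems.LangevinControlUVFemtoCurvatureTwoPointCTorusUpperAxis
import HarnessLib

/-!
# Route `LangevinControlUV`, crux `FemtoCurvatureTwoPointC` (stmt-QuantumFields-16204), line
# `conditional-covariance-floor` — V-corner: UNIFORM TORUS DOUBLING ON ALL BOXES and the uniform
# corner doubling UDC

Registered sub-goal `uniformDoubling_all` (`--supports stmt-QuantumFields-16204`), proved verbatim,
and its corollary `uniformDoubling_corner` = the hypothesis UDC of the landed V-corner bridge
`varianceCeilingCorner_of_uniformDoublingCorner` (`…CCornerBridge`, p162787): for a compact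
second-countable group `G` with a faithful continuous unitary lattice representation `r` there is ONE
`A = A(r)` with

  `Z_L(b/2) ≤ e^{A L⁴} · Z_L(b)`   for EVERY torus `(ℤ/L)⁴`, `L ≥ 2`, and EVERY `b ≥ 4`

— no restriction `log b ≤ L⁴` (the landed `uniformDoubling_bulk4` needed it: the `2D log b` slack of
the four wrap links). In the corner `L⁴ < log β`, `L ≥ 2` forces `β > e^{16} > 4`, whence UDC.

**Proof** (the holonomy-conditioned sandwich of the V-corner attack, notes `Vc-notes.md` §(c)).
With `M = 3L⁴ − 3`, `D = dimE r.ρ` and the one-site partition function `Z₁ = partitionFunction (L := 1)`: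
* UPPER (`torus_upper_axisHolonomy`, lattice Stokes + triangular integration with the axis-holonomy
  spectator): `Z_L(b/2) ≤ (C (b/4)^{−D/2})^M · Z₁(b/(4L²))`;
* LOWER (`torus_lower_axisHolonomy`, comb gauge + hyperplane twist): `Z_L(b) ≥ e^{−A₀L⁴} (C₁ b^{−D/2})^M · Z₁(2L²b)`;
* TEMPERATURE MISMATCH `(2L²b)/(b/(4L²)) = 8L⁴ ≤ 4^m`, `m = 2L + 2` (`L < 2^L`): `Z₁` is antitone in
  the temperature (`partitionFunction_antitone`, `S ≥ 0`) and doubles at every temperature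
  (`oneSite_partitionFunction_doubling`, p163946: `Z₁(t/4) ≤ K Z₁(t)`, iterated `m` times,
  `partitionFunction_iterate_quarter`), so `Z₁(b/(4L²)) ≤ K^m Z₁(2L²b)`;
* BOOKKEEPING in logarithms: the `log b` terms cancel EXACTLY (both exponents are `M`), leaving
  `M (log C − log C₁ + (D/2) log 4) + m log K + A₀ L⁴ ≤ A L⁴` with
  `A = 3 |log C − log C₁ + (D/2) log 4| + 3 log K + |A₀|` (`K ≥ 1`, `m ≤ 3L⁴`).

Everything is proved from Mathlib and landed tree files; no named facts, no definitions.
-/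

set_option autoImplicit false

noncomputable section

open scoped ENNReal
open MeasureTheory
open Literature.MathematicalPhysics.QuantumFieldTheory
open Summit.QuantumFields.YangMills.Theorems.FreeEnergyLogCoefficient (dimE)
open Summit.QuantumFields.YangMills.Theorems.FemtoCurvatureTwoPoint.PlaquetteVariance
  (partitionFunction_toReal_pos re_trace_le)

namespace Summit.QuantumFields.YangMills.Theorems.FemtoCurvatureTwoPointC.TorusGauge

section OneSite

variable {G : Type} [Group G] [TopologicalSpace G] [IsTopologicalGroup G] [CompactSpace G]
  [MeasurableSpace G] [BorelSpace G]

/-- **The partition function is antitone in the temperature**: `Z(β') ≤ Z(β)` for `β ≤ β'`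
(the Wilson action of a lattice representation is non-negative, `Re tr ≤ N`). -/
theorem partitionFunction_antitone (r : LatticeRep G) {L : ℕ} [NeZero L] {β β' : ℝ} (h : β ≤ β') :
    (partitionFunction (d := 4) (L := L) r.ρ β').toReal ≤
      (partitionFunction (d := 4) (L := L) r.ρ β).toReal := by
  have hZpos := partitionFunction_toReal_pos (d := 4) (L := L) r.ρ r.continuous β
  have hZtop : partitionFunction (d := 4) (L := L) r.ρ β ≠ ⊤ := (ENNReal.toReal_pos_iff.1 hZpos).2.ne
  refine ENNReal.toReal_mono hZtop ?_
  rw [OneSite.partitionFunction_eq_lintegral', OneSite.partitionFunction_eq_lintegral']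
  refine lintegral_mono fun U => ENNReal.ofReal_le_ofReal (Real.exp_le_exp.2 ?_)
  have hS : 0 ≤ wilsonAction r.ρ U :=
    Finset.sum_nonneg fun p _ => sub_nonneg.2 (re_trace_le r.ρ r.continuous _)
  nlinarith

/-- **Iterated one-site doubling**: if `Z₁(t/4) ≤ K Z₁(t)` for all `t > 0` (`K ≥ 0`), then
`Z₁(t/4^m) ≤ K^m Z₁(t)` for all `t > 0` and `m`. -/
theorem partitionFunction_iterate_quarter (r : LatticeRep G) {K : ℝ} (hK : 0 ≤ K)
    (hdbl : ∀ t : ℝ, 0 < t → (partitionFunction (d := 4) (L := 1) r.ρ (t / 4)).toReal ≤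
      K * (partitionFunction (d := 4) (L := 1) r.ρ t).toReal) :
    ∀ (m : ℕ) (t : ℝ), 0 < t → (partitionFunction (d := 4) (L := 1) r.ρ (t / 4 ^ m)).toReal ≤
      K ^ m * (partitionFunction (d := 4) (L := 1) r.ρ t).toReal := by
  intro m
  induction m with
  | zero => intro t _; simp
  | succ m ih =>
    intro t ht
    have h4m : (0 : ℝ) < 4 ^ m := pow_pos (by norm_num) m
    have hstep := hdbl (t / 4 ^ m) (div_pos ht h4m)
    rw [div_div, ← pow_succ] at hstep
    calc (partitionFunction (d := 4) (L := 1) r.ρ (t / 4 ^ (m + 1))).toReal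
        ≤ K * (partitionFunction (d := 4) (L := 1) r.ρ (t / 4 ^ m)).toReal := hstep
      _ ≤ K * (K ^ m * (partitionFunction (d := 4) (L := 1) r.ρ t).toReal) :=
          mul_le_mul_of_nonneg_left (ih t ht) hK
      _ = K ^ (m + 1) * (partitionFunction (d := 4) (L := 1) r.ρ t).toReal := by ring

end OneSite

/-- The temperature mismatch of the conditioned sandwich is a power of `4`: `8 L⁴ ≤ 4^{2L+2}`. -/
theorem eight_mul_pow_four_le (L : ℕ) : (8 * (L : ℝ) ^ 4) ≤ (4 : ℝ) ^ (2 * L + 2) := by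
  have h1 : L ^ 4 ≤ (2 ^ L) ^ 4 := Nat.pow_le_pow_left L.lt_two_pow_self.le 4
  have h2 : (8 * L ^ 4 : ℕ) ≤ 4 ^ (2 * L + 2) := by
    calc 8 * L ^ 4 ≤ 8 * (2 ^ L) ^ 4 := Nat.mul_le_mul_left 8 h1
      _ ≤ 16 * (2 ^ L) ^ 4 := Nat.mul_le_mul_right _ (by norm_num)
      _ = 4 ^ (2 * L + 2) := by
          rw [pow_add, pow_mul, ← pow_mul, mul_comm L 4, pow_mul]
          norm_num
          ring
  exact_mod_cast h2

/-- **Bookkeeping of the conditioned sandwich.** With `M ∈ [0, 3L⁴]`, `m ≤ 3L⁴`, `lK ≥ 0`: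
`M q + m lK + A₀ L⁴ ≤ (3|q| + 3 lK + |A₀|) L⁴`. -/
theorem doubling_bookkeeping_all {L4 M m q lK A₀ : ℝ} (hM0 : 0 ≤ M) (hM : M ≤ 3 * L4)
    (hm : m ≤ 3 * L4) (hlK : 0 ≤ lK) (hL4 : 0 ≤ L4) :
    M * q + m * lK + A₀ * L4 ≤ (3 * |q| + 3 * lK + |A₀|) * L4 := by
  have ha : M * q ≤ 3 * L4 * |q| := by
    nlinarith [mul_nonneg hM0 (sub_nonneg.2 (le_abs_self q)), mul_nonneg (sub_nonneg.2 hM) (abs_nonneg q)]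
  have hb : m * lK ≤ 3 * L4 * lK := mul_le_mul_of_nonneg_right hm hlK
  have hc : A₀ * L4 ≤ |A₀| * L4 := mul_le_mul_of_nonneg_right (le_abs_self _) hL4
  nlinarith [ha, hb, hc]

/-! ### The registered statements -/

/-- **Uniform torus free-energy doubling on ALL boxes** (registered sub-goal `uniformDoubling_all` of
line `conditional-covariance-floor`, crux `FemtoCurvatureTwoPointC`, stmt-QuantumFields-16204; the
signature verbatim): for a compact second-countable group `G` with a faithful continuous unitary
lattice representation `r` there is ONE `A` with `Z_L(b/2) ≤ e^{A L⁴} Z_L(b)` for every torus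
`(ℤ/L)⁴`, `L ≥ 2`, and every `b ≥ 4` — the holonomy-conditioned sandwich
(`torus_upper_axisHolonomy`, `torus_lower_axisHolonomy`), the iterated one-site doubling
(`oneSite_partitionFunction_doubling`) across the temperature mismatch `8L⁴ ≤ 4^{2L+2}`, the
antitonicity of `Z₁`, and the bookkeeping `doubling_bookkeeping_all`. -/
theorem uniformDoubling_all :
    ∀ {G : Type} [Group G] [TopologicalSpace G] [IsTopologicalGroup G] [CompactSpace G]
      [MeasurableSpace G] [BorelSpace G] [SecondCountableTopology G] (r : LatticeRep G),
      ∃ A : ℝ, ∀ (L : ℕ) [NeZero L] (b : ℝ), 2 ≤ L → 4 ≤ b →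
        (partitionFunction (d := 4) (L := L) r.ρ (b / 2)).toReal ≤
          Real.exp (A * (L : ℝ) ^ 4) * (partitionFunction (d := 4) (L := L) r.ρ b).toReal := by
  intro G _ _ _ _ _ _ _ r
  obtain ⟨C, hC, hup⟩ := torus_upper_axisHolonomy r
  obtain ⟨C₁, A₀, hC₁, hlow⟩ := torus_lower_axisHolonomy r
  obtain ⟨K₀, hK₀⟩ := oneSite_partitionFunction_doubling G r
  -- WLOG `K ≥ 1`
  set K : ℝ := max K₀ 1 with hKdef
  have hK1 : 1 ≤ K := le_max_right _ _
  have hK0 : 0 ≤ K := zero_le_one.trans hK1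
  have hKd : ∀ t : ℝ, 0 < t → (partitionFunction (d := 4) (L := 1) r.ρ (t / 4)).toReal ≤
      K * (partitionFunction (d := 4) (L := 1) r.ρ t).toReal := fun t ht =>
    (hK₀ t ht).trans (mul_le_mul_of_nonneg_right (le_max_left _ _) ENNReal.toReal_nonneg)
  -- the constant
  set q : ℝ := Real.log C - Real.log C₁ + (dimE r.ρ : ℝ) / 2 * Real.log 4 with hq
  refine ⟨3 * |q| + 3 * Real.log K + |A₀|, fun L _ b hL hb => ?_⟩
  have hb0 : 0 < b := by linarith
  have hb1 : 1 ≤ b := by linarith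
  have hL1 : (1 : ℝ) ≤ L := by exact_mod_cast (show 1 ≤ L by omega)
  have hL0 : (0 : ℝ) < L := by linarith
  have hL4 : (1 : ℝ) ≤ (L : ℝ) ^ 4 := one_le_pow₀ hL1
  -- the two temperatures of the one-site factor and their mismatch
  set s : ℝ := 2 * (L : ℝ) ^ 2 * b with hs
  set tu : ℝ := b / (4 * (L : ℝ) ^ 2) with htu
  have hs0 : 0 < s := by positivity
  have hmis : s / 4 ^ (2 * L + 2) ≤ tu := by
    rw [hs, htu, div_le_div_iff₀ (pow_pos (by norm_num) _) (by positivity)]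
    have h8 := eight_mul_pow_four_le L
    nlinarith [h8, hb0, pow_nonneg hL0.le 2]
  -- positivity of all partition functions
  have hZh := partitionFunction_toReal_pos (d := 4) (L := L) r.ρ r.continuous (b / 2)
  have hZb := partitionFunction_toReal_pos (d := 4) (L := L) r.ρ r.continuous b
  have hZu := partitionFunction_toReal_pos (d := 4) (L := 1) r.ρ r.continuous tu
  have hZs := partitionFunction_toReal_pos (d := 4) (L := 1) r.ρ r.continuous s
  -- the cardinality `M = 3L⁴ − 3` as a real number
  have hMle : 3 ≤ 3 * L ^ 4 := by
    have h4 : 0 < L ^ 4 := pow_pos (by omega) 4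
    omega
  have hM : ((3 * L ^ 4 - 3 : ℕ) : ℝ) = 3 * (L : ℝ) ^ 4 - 3 := by
    rw [Nat.cast_sub hMle]
    push_cast
    ring
  -- the power laws and their logarithms
  have hx : 0 < (b / 4) ^ (-((dimE r.ρ : ℝ) / 2)) := Real.rpow_pos_of_pos (by linarith) _
  have hy : 0 < b ^ (-((dimE r.ρ : ℝ) / 2)) := Real.rpow_pos_of_pos hb0 _
  have hlogx : Real.log ((b / 4) ^ (-((dimE r.ρ : ℝ) / 2))) =
      -((dimE r.ρ : ℝ) / 2) * (Real.log b - Real.log 4) := by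
    rw [Real.log_rpow (by linarith), Real.log_div hb0.ne' (by norm_num)]
  have hlogy : Real.log (b ^ (-((dimE r.ρ : ℝ) / 2))) = -((dimE r.ρ : ℝ) / 2) * Real.log b :=
    Real.log_rpow hb0 _
  -- UPPER half at `b`, in logarithmic form
  have hU : Real.log (partitionFunction (d := 4) (L := L) r.ρ (b / 2)).toReal ≤
      (3 * (L : ℝ) ^ 4 - 3) * (Real.log C + -((dimE r.ρ : ℝ) / 2) * (Real.log b - Real.log 4)) +
        Real.log (partitionFunction (d := 4) (L := 1) r.ρ tu).toReal := by
    have h := Real.log_le_log hZh (hup L b hL hb)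
    rwa [Real.log_mul (pow_pos (mul_pos hC hx) _).ne' hZu.ne', Real.log_pow,
      Real.log_mul hC.ne' hx.ne', hlogx, hM] at h
  -- the one-site factor across the temperature mismatch
  have hO : Real.log (partitionFunction (d := 4) (L := 1) r.ρ tu).toReal ≤
      (2 * L + 2 : ℕ) * Real.log K + Real.log (partitionFunction (d := 4) (L := 1) r.ρ s).toReal := by
    have h1 : (partitionFunction (d := 4) (L := 1) r.ρ tu).toReal ≤
        (partitionFunction (d := 4) (L := 1) r.ρ (s / 4 ^ (2 * L + 2))).toReal :=
      partitionFunction_antitone r hmis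
    have h2 := partitionFunction_iterate_quarter r hK0 hKd (2 * L + 2) s hs0
    have hKm : 0 < K ^ (2 * L + 2) := pow_pos (by linarith) _
    have h := Real.log_le_log hZu (h1.trans h2)
    rwa [Real.log_mul hKm.ne' hZs.ne', Real.log_pow] at h
  -- LOWER half at `b`, in logarithmic form
  have hLo : -(A₀ * (L : ℝ) ^ 4) + (3 * (L : ℝ) ^ 4 - 3) *
        (Real.log C₁ + -((dimE r.ρ : ℝ) / 2) * Real.log b) +
        Real.log (partitionFunction (d := 4) (L := 1) r.ρ s).toReal ≤
      Real.log (partitionFunction (d := 4) (L := L) r.ρ b).toReal := by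
    have hpos : 0 < Real.exp (-(A₀ * (L : ℝ) ^ 4)) *
        (C₁ * b ^ (-((dimE r.ρ : ℝ) / 2))) ^ (3 * L ^ 4 - 3) *
        (partitionFunction (d := 4) (L := 1) r.ρ s).toReal :=
      mul_pos (mul_pos (Real.exp_pos _) (pow_pos (mul_pos hC₁ hy) _)) hZs
    have h := Real.log_le_log hpos (hlow L b hL hb1)
    rwa [Real.log_mul (mul_pos (Real.exp_pos _) (pow_pos (mul_pos hC₁ hy) _)).ne' hZs.ne',
      Real.log_mul (Real.exp_pos _).ne' (pow_pos (mul_pos hC₁ hy) _).ne', Real.log_exp,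
      Real.log_pow, Real.log_mul hC₁.ne' hy.ne', hlogy, hM] at h
  -- bookkeeping: the `log b` terms cancel exactly
  have hkey : (3 * (L : ℝ) ^ 4 - 3) * (Real.log C + -((dimE r.ρ : ℝ) / 2) * (Real.log b - Real.log 4)) -
      (3 * (L : ℝ) ^ 4 - 3) * (Real.log C₁ + -((dimE r.ρ : ℝ) / 2) * Real.log b) =
        (3 * (L : ℝ) ^ 4 - 3) * q := by
    rw [hq]; ring
  have hm : ((2 * L + 2 : ℕ) : ℝ) ≤ 3 * (L : ℝ) ^ 4 := by
    have hL2 : (2 : ℝ) ≤ L := by exact_mod_cast hL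
    have h1 : (L : ℝ) ≤ (L : ℝ) ^ 4 := le_self_pow₀ hL1 (by norm_num)
    push_cast
    linarith
  have hbook := doubling_bookkeeping_all (q := q) (lK := Real.log K) (A₀ := A₀)
    (M := 3 * (L : ℝ) ^ 4 - 3) (m := ((2 * L + 2 : ℕ) : ℝ)) (L4 := (L : ℝ) ^ 4)
    (by linarith) (by linarith) hm (Real.log_nonneg hK1) (by positivity)
  -- exponentiate
  rw [← Real.log_le_log_iff hZh (mul_pos (Real.exp_pos _) hZb),
    Real.log_mul (Real.exp_pos _).ne' hZb.ne', Real.log_exp]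
  linarith [hU, hO, hLo, hkey, hbook]

/-- **The uniform corner doubling UDC** — the hypothesis of the landed V-corner bridge
`varianceCeilingCorner_of_uniformDoublingCorner` (`…CCornerBridge`), verbatim: ONE `A` with
`Z_L(β/2) ≤ e^{A L⁴} Z_L(β)` for all `L ≥ 2`, `β ≥ 2`, `L⁴ < log β`. In the corner `16 ≤ L⁴ < log β`,
so `β > e^{16} > 4` and `uniformDoubling_all` applies. -/
theorem uniformDoubling_corner :
    ∀ {G : Type} [Group G] [TopologicalSpace G] [IsTopologicalGroup G] [CompactSpace G]
      [MeasurableSpace G] [BorelSpace G] [SecondCountableTopology G] (r : LatticeRep G),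
      ∃ A : ℝ, ∀ (L : ℕ) [NeZero L] (β : ℝ), 2 ≤ L → 2 ≤ β → (L : ℝ) ^ 4 < Real.log β →
        (partitionFunction (d := 4) (L := L) r.ρ (β / 2)).toReal ≤
          Real.exp (A * (L : ℝ) ^ 4) * (partitionFunction (d := 4) (L := L) r.ρ β).toReal := by
  intro G _ _ _ _ _ _ _ r
  obtain ⟨A, hA⟩ := uniformDoubling_all r
  refine ⟨A, fun L _ β hL hβ hlog => hA L β hL ?_⟩
  have hβ0 : 0 < β := by linarith
  have hL2 : (2 : ℝ) ≤ L := by exact_mod_cast hL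
  have h16 : (16 : ℝ) ≤ (L : ℝ) ^ 4 := by
    have h := pow_le_pow_left₀ (by norm_num : (0 : ℝ) ≤ 2) hL2 4
    norm_num at h
    exact h
  have hexp : Real.exp 16 < β := by
    calc Real.exp 16 < Real.exp (Real.log β) := Real.exp_lt_exp.2 (by linarith)
      _ = β := Real.exp_log hβ0
  have h17 : (16 : ℝ) + 1 ≤ Real.exp 16 := Real.add_one_le_exp 16
  linarith

end Summit.QuantumFields.YangMills.Theorems.FemtoCurvatureTwoPointC.TorusGauge

end
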